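import Summits.BirchSwinnertonDyer.BirchSwinnertonDyer.Theses.ResidualThetaTransportAtTwo
import Summits.BirchSwinnertonDyer.BirchSwinnertonDyer.Theorems.ResidualThetaTransportAtTwoThetaLayerLambdaCongruenceAtTwoLayerLambdaStable
import Literature.NumberTheory.EllipticCurves.MazurTateElementCoeffField
import Literature.NumberTheory.IwasawaTheory.LayerIwasawaInvariants
import Literature.NumberTheory.EllipticCurves.GreenbergVatsal2000.NonPrimitivePAdicLFunction
import HarnessLib

/-!
# Crux `ThetaLayerLambdaCongruenceAtTwo` (stmt-BirchSwinnertonDyer-20688, route ResidualThetaTransportAtTwo), line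
# `birth`: REDUCTION of the crux to its research core — an integral congruence of the `S₀`-depleted layer
# Mazur–Tate elements at a COHOMOLOGICAL period (H) + unit sup norm of the partner's element (μ) + existence of a
# cohomological plus period — by PROVED ultrametric algebra
# (lead prover bsd-wall-rtt-p3 g0; `--supports stmt-BirchSwinnertonDyer-20688`; closes nothing)

HONEST FRAMING. THEOREMS ONLY; the three research inputs are explicit hypotheses spelled inline (they are the stubs
`stub_depletedLayerCongruenceCoh` (H), `stub_depletedLayerMuCoh` (μ), `stub_exists_cohomologicalPlusPeriod` (coh) of the
lead's skeleton v3 of line `birth`); nothing about any curve or form is asserted; BSD is not proved by any of this.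

WHY THIS SHAPE. The registered analytic heart A1 of the birth line (`stub_depletedLayerCongruence`: for large even `n`
there is `c ≠ 0` with `‖Θ_n^{S₀}(W) − c·Θ_n^{S₀}(g;Ω)‖_sup < ‖Θ_n^{S₀}(W)‖_sup`) is, on paper, Greenberg–Vatsal (10) /
Vatsal 1999 Thm. (1.10) / Emerton–Pollack–Weston Thm. 1 / Corpuz–Lei 2025 Prop. 4.2 READ AT `p = 2`, and its printed
proof (odd `p`) has TWO inputs of different nature: (H) in COHOMOLOGICAL normalisations (Pollack–Weston Def. 2.1: the
`ι`-adic sup of the plus symbol values is `1`) the depleted layer elements of the two congruent forms are congruent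
modulo the maximal ideal — multiplicity one mod `p` on `H¹_P(Γ₁(M'), 𝒪)^±_𝔪` for the depleted forms plus Ihara's lemma
(Corpuz–Lei §2.2; at `p = 2` on the habitat⁺, where `ρ̄ = W[2]` is absolutely irreducible, ramified at `2` and complex
conjugation acts on `W[2]` as a transvection because `Δ_W < 0`, the plus eigenline of `ρ̄` is ONE-dimensional and
Buzzard's mod-`2` multiplicity one (Ribet–Stein Thm. 6.1) is the substitute — NOT in print: research); and (μ) the
layer element has `μ = 0` in that normalisation, i.e. a unit coefficient (Greenberg's / Perrin-Riou's `μ = 0`;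
certified numerically on 33 habitat classes only). §3 proves A1-for-every-plus-period, hence the CRUX BY NAME, from
(H) + (μ) at ONE cohomological period + (coh) the existence of such a period (= the registered stub
`stub_exists_cohomologicalPlusPeriod` of the sibling crux K0⁺ι 20690, verbatim), using: §1 the ultrametric algebra
(`layerLambda` is invariant under `C c·`, `c ≠ 0`, landed A2 `stub_layerLambda_stable` p565681; the symmetric form of
A1), §2 CHANGE OF PERIOD — two plus periods of `g` rescale `θ_n(g;Ω)` by a non-zero `α ∈ K_g` (PW Def. 2.1 "well-defined
up to scaling"; proved from the definitions, Literature proposal p566646 — a private copy is kept here so that this file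
stands alone), so the `g`-side layer `λ` of the crux does NOT depend on the plus period `Ω`
(`layerLambda_partnerSide_eq_of_isPlusPeriod`).

References: [GreenbergVatsal2000] (10), Thm. (1.4); [Vatsal1999] Thm. (1.10); [EmertonPollackWeston2006] Thm. 1;
[CorpuzLei2025] Prop. 2.4/4.2 (arXiv:2508.09733, p ≥ 3); [PollackWeston2011MT] §2.2, Def. 2.1, Rem. 2.2, §3.1;
[RibetStein2008] Thm. 6.1 (Buzzard).
-/

noncomputable section

-- justification: the `Summit.BirchSwinnertonDyer.BirchSwinnertonDyer.…` path repeats a component (route-file convention)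
set_option linter.dupNamespace false

open scoped Classical

open Polynomial

open Literature.NumberTheory.IwasawaTheory Literature.NumberTheory.EllipticCurves
  Literature.NumberTheory.EllipticCurves.ModularForms

namespace Summit.BirchSwinnertonDyer.BirchSwinnertonDyer.Theorems.ThetaLayerLambdaCongruenceAtTwo

/-! ## §1. Ultrametric algebra: `λ(C c·θ) = λ(θ)`, symmetric form of A1 -/

section Algebra

variable {K : Type*} [NormedField K]

/-- `‖−θ‖_sup = ‖θ‖_sup`. [folklore] -/
theorem supNorm_neg' (θ : K[X]) : (-θ).supNorm = θ.supNorm := by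
  rw [show -θ = C (-1 : K) * θ by simp, supNorm_C_mul, norm_neg, norm_one, one_mul]

/-- `‖θ − θ'‖_sup = ‖θ' − θ‖_sup`. [folklore] -/
theorem supNorm_sub_comm (θ θ' : K[X]) : (θ - θ').supNorm = (θ' - θ).supNorm := by
  rw [← supNorm_neg' (θ - θ'), neg_sub]

/-- `(C c · p) %ₘ q = C c · (p %ₘ q)`. [folklore] -/
theorem C_mul_modByMonic {R : Type*} [CommRing R] (c : R) (p q : R[X]) : (C c * p) %ₘ q = C c * (p %ₘ q) := by
  rw [C_mul', C_mul', smul_modByMonic]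

variable [IsUltrametricDist K]

/-- **`λ` is invariant under a non-zero rescaling**: `layerLambda (C c * θ) = layerLambda θ` for `c ≠ 0`
(Pollack–Weston §3.1; from the landed A2 `layerLambda_eq_of_supNorm_sub_C_mul_lt` with the zero perturbation).
[cite: PollackWeston2011MT, §3.1] -/
theorem layerLambda_C_mul {c : K} (hc : c ≠ 0) (θ : K[X]) : layerLambda (C c * θ) = layerLambda θ := by
  by_cases hθ : θ = 0
  · subst hθ
    rw [mul_zero]
  · apply layerLambda_eq_of_supNorm_sub_C_mul_lt hc
    rw [sub_self, supNorm_zero, supNorm_C_mul]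
    exact mul_pos (norm_pos_iff.mpr hc)
      (lt_of_le_of_ne (supNorm_nonneg θ) (Ne.symm ((supNorm_eq_zero_iff θ).not.mpr hθ)))

/-- **Symmetric form of A1.** If `‖C a·θ' − θ‖_sup < ‖θ‖_sup` then `a ≠ 0` and
`‖θ' − C a⁻¹·θ‖_sup < ‖θ'‖_sup` (all triangles are isosceles: `‖C a·θ'‖_sup = ‖θ‖_sup`). [folklore] -/
theorem ne_zero_and_supNorm_sub_C_inv_mul_lt {θ θ' : K[X]} {a : K} (h : (C a * θ' - θ).supNorm < θ.supNorm) :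
    a ≠ 0 ∧ (θ' - C a⁻¹ * θ).supNorm < θ'.supNorm := by
  have ha : a ≠ 0 := by
    rintro rfl
    rw [map_zero, zero_mul, zero_sub, supNorm_neg'] at h
    exact lt_irrefl _ h
  refine ⟨ha, ?_⟩
  -- `‖C a θ'‖ = ‖θ‖`
  have h1 : (θ - C a * (θ')).supNorm < θ.supNorm := by rwa [supNorm_sub_comm]
  have heq : ‖a‖ * θ'.supNorm = θ.supNorm := by
    rw [← supNorm_C_mul]
    -- isosceles on the sup norm: both `≤` from the ultrametric inequality coefficientwise
    apply le_antisymm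
    · obtain ⟨i, hi⟩ := (C a * θ').exists_eq_supNorm
      rw [hi]
      have hci : ‖θ.coeff i - (C a * θ').coeff i‖ < θ.supNorm := by
        rw [← coeff_sub]; exact ((θ - C a * θ').le_supNorm i).trans_lt h1
      rcases eq_or_lt_of_le (θ.le_supNorm i) with he | hl
      · exact (norm_eq_of_norm_sub_lt_of_norm_eq hci he).le
      · exact (norm_lt_of_norm_sub_lt_of_norm_lt hci hl).le
    · obtain ⟨i, hi⟩ := θ.exists_eq_supNorm
      have hci : ‖θ.coeff i - (C a * θ').coeff i‖ < θ.supNorm := by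
        rw [← coeff_sub]; exact ((θ - C a * θ').le_supNorm i).trans_lt h1
      rw [← norm_eq_of_norm_sub_lt_of_norm_eq hci hi.symm]
      exact (C a * θ').le_supNorm i
  have hapos : 0 < ‖a‖ := norm_pos_iff.mpr ha
  -- rescale the difference by `a⁻¹`
  have hsc : θ' - C a⁻¹ * θ = C a⁻¹ * (C a * θ' - θ) := by
    rw [mul_sub, ← mul_assoc, ← map_mul, inv_mul_cancel₀ ha, map_one, one_mul]
  rw [hsc, supNorm_C_mul, norm_inv]
  calc ‖a‖⁻¹ * (C a * θ' - θ).supNorm < ‖a‖⁻¹ * θ.supNorm :=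
        mul_lt_mul_of_pos_left h (inv_pos.mpr hapos)
    _ = θ'.supNorm := by rw [← heq, ← mul_assoc, inv_mul_cancel₀ hapos.ne', one_mul]

end Algebra

/-! ## §2. Change of period: the partner-side layer `λ` does not depend on the plus period -/

section ChangeOfPeriod

variable {N : ℕ} {g : CuspForm (CongruenceSubgroup.Gamma0 N) 2}

/-- Local copy (private; Literature proposal p566646 `IsPlusPeriod.exists_plusSymbolK_eq_mul`): two plus periods of
`g` rescale the `K_g`-valued plus symbols by a non-zero `α ∈ K_g` (Pollack–Weston Def. 2.1 "well-defined up to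
scaling"). [cite: PollackWeston2011MT, §2.2 and Def. 2.1] -/
private theorem exists_plusSymbolK_eq_mul_aux {Ω Ω' : ℂ} (hΩ : IsPlusPeriod g Ω) (hΩ' : IsPlusPeriod g Ω') :
    ∃ α : coeffField g, α ≠ 0 ∧ ∀ r : ℚ, plusSymbolK g Ω r = α * plusSymbolK g Ω' r := by
  classical
  by_cases h : ∃ r₀ : ℚ, plusSymbol g r₀ ≠ 0
  · obtain ⟨r₀, hr₀⟩ := h
    have hne : ∀ (Ω₁ : ℂ), IsPlusPeriod g Ω₁ → plusSymbolK g Ω₁ r₀ ≠ 0 := by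
      intro Ω₁ hΩ₁ h0
      have h1 : ((plusSymbolK g Ω₁ r₀ : coeffField g) : ℂ) = 0 := by
        rw [h0]
        rfl
      rw [IsPlusPeriod.coe_plusSymbolK g hΩ₁, div_eq_zero_iff] at h1
      rcases h1 with h1 | h1
      · exact hr₀ h1
      · exact hΩ₁.1 h1
    refine ⟨plusSymbolK g Ω r₀ / plusSymbolK g Ω' r₀, div_ne_zero (hne Ω hΩ) (hne Ω' hΩ'),
      fun r ↦ ?_⟩
    apply Subtype.ext
    rw [IntermediateField.coe_mul, IntermediateField.coe_div,
      IsPlusPeriod.coe_plusSymbolK g hΩ, IsPlusPeriod.coe_plusSymbolK g hΩ,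
      IsPlusPeriod.coe_plusSymbolK g hΩ', IsPlusPeriod.coe_plusSymbolK g hΩ']
    have hΩ0 : Ω ≠ 0 := hΩ.1
    have hΩ'0 : Ω' ≠ 0 := hΩ'.1
    field_simp
  · push Not at h
    refine ⟨1, one_ne_zero, fun r ↦ ?_⟩
    have hz : ∀ (Ω₁ : ℂ), IsPlusPeriod g Ω₁ → plusSymbolK g Ω₁ r = 0 := by
      intro Ω₁ hΩ₁
      apply Subtype.ext
      rw [IsPlusPeriod.coe_plusSymbolK g hΩ₁, h r, zero_div]
      rfl
    rw [hz Ω hΩ, hz Ω' hΩ', mul_zero]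

/-- **Change of period on the Mazur–Tate elements, read along `ι`.** For two plus periods `Ω, Ω'` of `g` and an
embedding `ι : K_g → ℚ̄_p` there is `β ∈ ℚ̄_p`, `β ≠ 0`, with `(θ_n(g;Ω)).map ι = C β · (θ_n(g;Ω')).map ι` for every
`n` (`β = ι α`, PW Def. 2.1 "well-defined up to scaling"). [cite: PollackWeston2011MT, §2.1 (2.1), §2.2 and Def. 2.1] -/
theorem exists_map_mazurTateElementK_eq_C_mul {p : ℕ} [Fact p.Prime] (ι : coeffField g →+* PadicAlgCl p)
    {Ω Ω' : ℂ} (hΩ : IsPlusPeriod g Ω) (hΩ' : IsPlusPeriod g Ω') :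
    ∃ β : PadicAlgCl p, β ≠ 0 ∧ ∀ n : ℕ,
      (mazurTateElementK g Ω p n).map ι = C β * (mazurTateElementK g Ω' p n).map ι := by
  obtain ⟨α, hα, h⟩ := exists_plusSymbolK_eq_mul_aux hΩ hΩ'
  refine ⟨ι α, (map_ne_zero ι).mpr hα, fun n ↦ ?_⟩
  classical
  haveI := neZero_torsionOrder p
  haveI := Fintype.ofFinite (rootsOfUnity (torsionOrder p) ℤ_[p])
  have hθ : mazurTateElementK g Ω p n = C α * mazurTateElementK g Ω' p n := by
    simp only [mazurTateElementK, finsum_eq_sum_of_fintype, Finset.mul_sum, h, map_mul, mul_assoc]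
  rw [hθ, Polynomial.map_mul, map_C]

/-- **The partner side of the crux does not depend on the plus period.** For plus periods `Ω, Ω'` of `g`, any
`E, ω ∈ ℚ̄₂[X]` (the `S₀`-depletion factor and the layer modulus) and any `n`, the layer `λ`-invariants of
`((θ_n(g;Ω)).map ι · E) %ₘ ω` and `((θ_n(g;Ω')).map ι · E) %ₘ ω` agree (change of period is a non-zero scalar, and
`λ(C β · θ) = λ(θ)`). [cite: PollackWeston2011MT, Def. 2.1 and §3.1] -/
theorem layerLambda_partnerSide_eq_of_isPlusPeriod {p : ℕ} [Fact p.Prime] (ι : coeffField g →+* PadicAlgCl p)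
    {Ω Ω' : ℂ} (hΩ : IsPlusPeriod g Ω) (hΩ' : IsPlusPeriod g Ω') (E ω : (PadicAlgCl p)[X]) (n : ℕ) :
    layerLambda (((mazurTateElementK g Ω p n).map ι * E) %ₘ ω) =
      layerLambda (((mazurTateElementK g Ω' p n).map ι * E) %ₘ ω) := by
  obtain ⟨β, hβ, h⟩ := exists_map_mazurTateElementK_eq_C_mul ι hΩ hΩ'
  rw [h n, mul_assoc, C_mul_modByMonic, layerLambda_C_mul hβ]

end ChangeOfPeriod

/-! ## §3. The crux from (H) + (μ) at a cohomological period + (coh) -/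

/-- **Crux `ThetaLayerLambdaCongruenceAtTwo` BY NAME from the three research stubs of skeleton v3 of line `birth`.**
(H) `stub_depletedLayerCongruenceCoh`: on the habitat⁺, for every partner datum `(M, g, ι, Ω)` with `Ω` a
COHOMOLOGICAL plus period of `g` along `ι`, every newform `f` of `W` and every admissible `S₀`, for all large even `n`
there is a scalar `a ∈ ℚ̄₂` with `‖C a·Θ^{S₀}_n(W) − Θ^{S₀}_n(g;Ω)‖_sup < 1` (integral congruence modulo the maximal
ideal — Vatsal (1.10) / GV (10) / Corpuz–Lei Prop. 2.4 read at `2`; research); (μ) `stub_depletedLayerMuCoh`: in the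
same situation `‖Θ^{S₀}_n(g;Ω)‖_sup = 1` for all large even `n` (`μ = 0` of the partner's depleted layer elements in
the cohomological normalisation; research); (coh) `stub_exists_cohomologicalPlusPeriod`: every newform on `Γ₀(M)` has
a cohomological plus period along every `ι` (PW Def. 2.1 "clearly always exist"; = the registered stub of crux 20690).
PROOF: for an arbitrary plus period `Ω'` of the crux, pick a cohomological `Ω` (coh); at a large even layer, (H) and
(μ) give `‖C a·Θ_W − Θ_g(Ω)‖ < 1 = ‖Θ_g(Ω)‖`, whence (§1, isosceles) `a ≠ 0` and `‖Θ_W − C a⁻¹·Θ_g(Ω)‖ < ‖Θ_W‖`, so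
`λ(Θ_W) = λ(Θ_g(Ω))` by the landed A2 `stub_layerLambda_stable`; and `λ(Θ_g(Ω)) = λ(Θ_g(Ω'))` by §2.
[cite: GreenbergVatsal2000, (10) and Thm. (1.4) (shape; the three inputs are hypotheses)] -/
theorem thetaLayerLambdaCongruenceAtTwo_of_cohStubs
    (hH : ∀ (W : WeierstrassCurve ℚ) [W.IsElliptic] [W.IsGloballyMinimal], ¬ W.HasCM → W.analyticRank = 0 → Literature.NumberTheory.EllipticCurves.Rank1Residual.GoodSS W 2 → W.frobeniusTrace 2 = 0 → W.Δ < 0 → ∀ (M : ℕ) [NeZero M] (g : CuspForm (CongruenceSubgroup.Gamma0 M) 2) (ι : Literature.NumberTheory.EllipticCurves.ModularForms.coeffField g →+* PadicAlgCl 2) (Ω : ℂ), Odd M → Literature.NumberTheory.EllipticCurves.ModularForms.IsNewform0 g → Literature.NumberTheory.Automorphic.IsCMForm (Literature.NumberTheory.EllipticCurves.ModularForms.liftToGamma1 M 2 g) → Literature.NumberTheory.EllipticCurves.ModularForms.cuspCoeff g 2 = 0 → Literature.NumberTheory.EllipticCurves.IsCohomologicalPlusPeriod g ι Ω → (∀ ℓ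 : ℕ, ℓ.Prime → ¬ ℓ ∣ 2 * M * W.conductorNorm ℤ → ‖Literature.NumberTheory.EllipticCurves.embCoeff g ι ℓ - (W.frobeniusTrace ℓ : PadicAlgCl 2)‖ < 1) → ∀ [NeZero (W.conductorNorm ℤ)] (f : CuspForm (CongruenceSubgroup.Gamma0 (W.conductorNorm ℤ)) 2), Literature.NumberTheory.EllipticCurves.ModularForms.IsNewformOf W f → ∀ (S₀ : Finset (IsDedekindDomain.HeightOneSpectrum (NumberField.RingOfIntegers ℚ))), (∀ v ∈ S₀, ((2 : ℕ) : NumberField.RingOfIntegers ℚ) ∉ v.asIdeal) → (∀ v : IsDedekindDomain.HeightOneSpectrum (NumberField.RingOfIntegers ℚ), ¬ W.HasGoodReductionAt v → v ∈ S₀) → (∀ v : IsDedekindDomain.HeightOneSpectrum (NumberField.RingOfIntegers ℚ), Rat.HeightOneSpectrum.natGenerator v ∣ M → v ∈ S₀) → ∃ n₀ : ℕ, ∀ n ≥ n₀, Even n → ∃ a : PadicAlgCl 2, (Polynomial.C a * (((Literature.NumberTheory.EllipticCurves.mazurTateElement f 2 n).map (algebraMap ℚ (PadicAlgCl 2)) *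 ∏ v ∈ S₀, ((W.localPolynomialAt v).map (Int.castRingHom (PadicAlgCl 2))).comp (Polynomial.C ((Rat.HeightOneSpectrum.natGenerator v : PadicAlgCl 2)⁻¹) * (Polynomial.X + 1) ^ (PadicInt.toZModPow n (-(Literature.NumberTheory.EllipticCurves.GreenbergVatsal2000.frobeniusExponent 2 (Rat.HeightOneSpectrum.natGenerator v : ℤ_[2])))).val)) %ₘ ((Polynomial.X + 1) ^ 2 ^ n - 1)) - (((Literature.NumberTheory.EllipticCurves.mazurTateElementK g Ω 2 n).map ι * ∏ v ∈ S₀, (1 - Polynomial.C (Literature.NumberTheory.EllipticCurves.embCoeff g ι (Rat.HeightOneSpectrum.natGenerator v)) * Polynomial.X + (if Rat.HeightOneSpectrum.natGenerator v ∣ M then 0 else Polynomial.C (Rat.HeightOneSpectrum.natGenerator v : PadicAlgCl 2)) * Polynomial.X ^ 2).comp (Polynomial.C ((Rat.HeightOneSpectrum.natGenerator v : PadicAlgCl 2)⁻¹) * (Polynomial.X + 1) ^ (PadicInt.toZModPow n (-(Literature.NumberTheory.EllipticCurves.GreenbergVatsal2000.frobeniusExponent 2 (Rat.HeightOneSpectrum.natGenerator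 v : ℤ_[2])))).val)) %ₘ ((Polynomial.X + 1) ^ 2 ^ n - 1))).supNorm < 1)
    (hμ : ∀ (W : WeierstrassCurve ℚ) [W.IsElliptic] [W.IsGloballyMinimal], ¬ W.HasCM → W.analyticRank = 0 → Literature.NumberTheory.EllipticCurves.Rank1Residual.GoodSS W 2 → W.frobeniusTrace 2 = 0 → W.Δ < 0 → ∀ (M : ℕ) [NeZero M] (g : CuspForm (CongruenceSubgroup.Gamma0 M) 2) (ι : Literature.NumberTheory.EllipticCurves.ModularForms.coeffField g →+* PadicAlgCl 2) (Ω : ℂ), Odd M → Literature.NumberTheory.EllipticCurves.ModularForms.IsNewform0 g → Literature.NumberTheory.Automorphic.IsCMForm (Literature.NumberTheory.EllipticCurves.ModularForms.liftToGamma1 M 2 g) → Literature.NumberTheory.EllipticCurves.ModularForms.cuspCoeff g 2 = 0 → Literature.NumberTheory.EllipticCurves.IsCohomologicalPlusPeriod g ι Ω → (∀ ℓ : ℕ, ℓ.Prime → ¬ ℓ ∣ 2 * M * W.conductorNorm ℤ → ‖Literature.NumberTheory.EllipticCurves.embCoeff g ι ℓ - (W.frobeniusTrace ℓ : PadicAlgCl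 2)‖ < 1) → ∀ [NeZero (W.conductorNorm ℤ)] (f : CuspForm (CongruenceSubgroup.Gamma0 (W.conductorNorm ℤ)) 2), Literature.NumberTheory.EllipticCurves.ModularForms.IsNewformOf W f → ∀ (S₀ : Finset (IsDedekindDomain.HeightOneSpectrum (NumberField.RingOfIntegers ℚ))), (∀ v ∈ S₀, ((2 : ℕ) : NumberField.RingOfIntegers ℚ) ∉ v.asIdeal) → (∀ v : IsDedekindDomain.HeightOneSpectrum (NumberField.RingOfIntegers ℚ), ¬ W.HasGoodReductionAt v → v ∈ S₀) → (∀ v : IsDedekindDomain.HeightOneSpectrum (NumberField.RingOfIntegers ℚ), Rat.HeightOneSpectrum.natGenerator v ∣ M → v ∈ S₀) → ∃ n₀ : ℕ, ∀ n ≥ n₀, Even n → (((Literature.NumberTheory.EllipticCurves.mazurTateElementK g Ω 2 n).map ι * ∏ v ∈ S₀, (1 - Polynomial.C (Literature.NumberTheory.EllipticCurves.embCoeff g ι (Rat.HeightOneSpectrum.natGenerator v)) * Polynomial.X + (if Rat.HeightOneSpectrum.natGenerator v ∣ M then 0 else Polynomial.C (Rat.HeightOneSpectrum.natGenerator v : PadicAlgCl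 2)) * Polynomial.X ^ 2).comp (Polynomial.C ((Rat.HeightOneSpectrum.natGenerator v : PadicAlgCl 2)⁻¹) * (Polynomial.X + 1) ^ (PadicInt.toZModPow n (-(Literature.NumberTheory.EllipticCurves.GreenbergVatsal2000.frobeniusExponent 2 (Rat.HeightOneSpectrum.natGenerator v : ℤ_[2])))).val)) %ₘ ((Polynomial.X + 1) ^ 2 ^ n - 1)).supNorm = 1)
    (hcoh : ∀ (M : ℕ) [NeZero M] (g : CuspForm (CongruenceSubgroup.Gamma0 M) 2) (ι : Literature.NumberTheory.EllipticCurves.ModularForms.coeffField g →+* PadicAlgCl 2), Literature.NumberTheory.EllipticCurves.ModularForms.IsNewform0 g → ∃ Ω : ℂ, Literature.NumberTheory.EllipticCurves.IsCohomologicalPlusPeriod g ι Ω) :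
    Summit.BirchSwinnertonDyer.BirchSwinnertonDyer.Theses.ResidualThetaTransportAtTwo.ThetaLayerLambdaCongruenceAtTwo := by
  intro W _ _ hcm hr hss ha hΔ M _ g ι Ω' hodd hnew hcmg ha2 hΩ' hcong _ f hf S₀ hS2 hSW hSM
  -- a cohomological plus period `Ω` of `g` along `ι`
  obtain ⟨Ω, hΩ⟩ := hcoh M g ι hnew
  obtain ⟨n₁, hn₁⟩ := hH W hcm hr hss ha hΔ M g ι Ω hodd hnew hcmg ha2 hΩ hcong f hf S₀ hS2 hSW hSM
  obtain ⟨n₂, hn₂⟩ := hμ W hcm hr hss ha hΔ M g ι Ω hodd hnew hcmg ha2 hΩ hcong f hf S₀ hS2 hSW hSM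
  refine ⟨max n₁ n₂, fun n hn he ↦ ?_⟩
  obtain ⟨a, ha⟩ := hn₁ n ((le_max_left _ _).trans hn) he
  have hμn := hn₂ n ((le_max_right _ _).trans hn) he
  -- (H) + (μ): `‖C a Θ_W − Θ_g(Ω)‖ < ‖Θ_g(Ω)‖`, hence A1 in symmetric form
  rw [← hμn] at ha
  obtain ⟨ha0, hlt⟩ := ne_zero_and_supNorm_sub_C_inv_mul_lt ha
  -- A2 (landed): `λ(Θ_W) = λ(Θ_g(Ω))`
  have h1 := stub_layerLambda_stable _ _ (a⁻¹) (inv_ne_zero ha0) hlt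
  -- change of period: `λ(Θ_g(Ω)) = λ(Θ_g(Ω'))`
  rw [h1]
  exact layerLambda_partnerSide_eq_of_isPlusPeriod ι hΩ.isPlusPeriod hΩ' _ _ n

end Summit.BirchSwinnertonDyer.BirchSwinnertonDyer.Theorems.ThetaLayerLambdaCongruenceAtTwo

end
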